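import Summits.BirchSwinnertonDyer.BirchSwinnertonDyer.Theorems.AlignedTransportAtTwoMainConjectureTransportAlignedAtTwoDeltaPosCongruenceForms
import Summits.BirchSwinnertonDyer.BirchSwinnertonDyer.Theorems.AlignedTransportAtTwoMainConjectureTransportAlignedAtTwoDeltaPosOddManin
import HarnessLib

/-!
# Crux C1 `MainConjectureTransportAlignedAtTwo` (stmt-BirchSwinnertonDyer-22296), line `birth`: the `Δ > 0` residual (R1) `stub_lamLawDeltaPos` — ITS STATEMENT
# VERBATIM FROM SIX TREE-NAMED PRINT FACTS and nothing else (width seat att-p3 g14; `--supports 22296`)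

THEOREMS ONLY (no `def`, no named fact, no `sorry`). CONDITIONAL on six PRINT-type named facts of the tree, taken as hypotheses:
`heckeSelfDual_torsionBy_J0` (DDT Lemma 1.38), `buzzard2000_multiplicityOne_gamma0` (Buzzard 2000 Prop. 2.4), `realPeriodRat_eq_unit_mul_plusPeriod_two` (plus
period unit at `2`), `exists_isNewformOf` (modularity), `integral_neronScaling_of_isGloballyMinimal` (Néron mapping property),
`nonempty_modularJacobianGaloisDataWithForms` (T1⁺: `J₀(L)` and the Jacobi maps of rational lattice-compatible forms are defined over `ℚ`, p669569).
BSD is not proved by this; C1 is not closed by this (the Kilford residual R2 `stub_lamLawKilford` is untouched); `stub_lamLawDeltaPos` is discharged MODULO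
these six facts — the next lead may register it as a theorem of PRINT stubs (v25).

**`lamLawDeltaPos_of_facts`** = `…DeltaPosCongruenceForms.lamLawDeltaPos_of_print` (this seat, p670839: the (G4) assembly for all conductors modulo
{PRINT³, T1⁺, T4}) with T4 supplied by att-p4 g13's KERNEL theorem `…DeltaPosOddManin.exists_datum_odd_maninConstant` (p670841: every curve of the cell has a
parametrisation datum at its conductor level with ODD Manin constant, from modularity + Néron scaling + the period unit; REF2: Česnavičius 2018 (MM-2) /
Abbes–Ullmo Thm A + odd-isogeny transport, Kriz–Li 2019 §5). The equal-conductor twin via the T1 carrier is att-p4 g13's `…DeltaPosCongruenceOfFacts`.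

References: Greenberg–Vatsal 2000 Thm. (1.4); Darmon–Diamond–Taylor 1995 §1.5–§1.7, Lemma 1.38; Buzzard 2000 Prop. 2.4; Abbes–Ullmo 1996 Thm A;
Česnavičius 2018; Kriz–Li 2019 §5; Matsuno 2008 Thm. 4.2.
-/

noncomputable section

-- justification: the `Summit.BirchSwinnertonDyer.BirchSwinnertonDyer.…` path repeats a component (route-file convention)
set_option linter.dupNamespace false
set_option autoImplicit false

open scoped MatrixGroups ModularForm NumberField Classical
open CongruenceSubgroup Complex WeierstrassCurve IsDedekindDomain Polynomial Module
open Literature.NumberTheory.EllipticCurves Literature.NumberTheory.EllipticCurves.ModularForms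
open Literature.NumberTheory.EllipticCurves.Greenberg1999 Literature.NumberTheory.EllipticCurves.GreenbergVatsal2000
open Summit.BirchSwinnertonDyer.Rank1Residual.F1Sign2 Summit.BirchSwinnertonDyer.Rank1Residual.X1.MuLambda
open Summit.BirchSwinnertonDyer.BirchSwinnertonDyer.Theorems.AlignedTransportAtTwoDeltaPosCongruenceForms
open Summit.BirchSwinnertonDyer.BirchSwinnertonDyer.Theorems.AlignedTransportAtTwoDeltaPosOddManin

namespace Summit.BirchSwinnertonDyer.BirchSwinnertonDyer.Theorems.AlignedTransportAtTwoDeltaPosCongruenceLevelOfFacts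

/-- **(R1) `stub_lamLawDeltaPos` — its statement VERBATIM — from six tree-named PRINT facts** (Hecke self-duality, Buzzard's multiplicity one off the
Kilford stratum, the plus period unit at `2`, modularity, Néron scaling, the `ℚ`-structure of `J₀(L)` with forms). The pure `λ`-law at `2` on aligned
good-ordinary `S₃` pairs with `W₁` off the Kilford stratum and `Δ(W₁) > 0`, ANY conductors (the binders `AlignedAtTwo`, non-twist, `Δ(W₁) ∉ ℚ²` are idle).
[cite: GreenbergVatsal2000, Thm. (1.4) and §3] [cite: DarmonDiamondTaylor1995, §1.5 and §1.7, §1.6 Lemma 1.38]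
[cite: Buzzard2000LevelLoweringModTwo, Prop. 2.4] [cite: AbbesUllmo1996, Thm. A] -/
theorem lamLawDeltaPos_of_facts
    (hSD : heckeSelfDual_torsionBy_J0) (hBz : buzzard2000_multiplicityOne_gamma0) (hΩu : realPeriodRat_eq_unit_mul_plusPeriod_two)
    (hmod : exists_isNewformOf) (hNS : integral_neronScaling_of_isGloballyMinimal) (hJ : nonempty_modularJacobianGaloisDataWithForms) :
    ∀ (W₁ : WeierstrassCurve ℚ) [W₁.IsElliptic] [W₁.IsGloballyMinimal]
      (W₂ : WeierstrassCurve ℚ) [W₂.IsElliptic] [W₂.IsGloballyMinimal],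
      IsOrdinaryAt W₁ 2 → IsOrdinaryAt W₂ 2 →
      (∀ x : ℚ, ¬ HasRationalTwoTorsionX W₁ x) → (∀ x : ℚ, ¬ HasRationalTwoTorsionX W₂ x) →
      ¬ IsSquare W₁.Δ → ¬ IsSquare W₂.Δ →
      (¬ ∃ (d : ℚ) (c : WeierstrassCurve.VariableChange ℚ), c • W₁.quadraticTwist d = W₂) →
      ¬ OnKilfordStratumAtTwo W₁ → 0 < W₁.Δ →
      ∀ (F : Type) [Field F] [NumberField F], Module.finrank ℚ F = 3 →
      ∀ e₁ e₂ : F, aeval e₁ (twoDivisionUCubic W₁) = 0 → aeval e₂ (twoDivisionUCubic W₂) = 0 →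
      AlignedAtTwo F e₁ e₂ → AlignedAtInfinity F (twoDivisionUCubic W₁) (twoDivisionUCubic W₂) e₁ e₂ →
      ∀ [NeZero (W₁.conductorNorm ℤ)] [NeZero (W₂.conductorNorm ℤ)]
        (f₁ : CuspForm (Gamma0 (W₁.conductorNorm ℤ)) 2), IsNewformOf W₁ f₁ →
      ∀ (f₂ : CuspForm (Gamma0 (W₂.conductorNorm ℤ)) 2), IsNewformOf W₂ f₂ →
      ∀ G₁ G₂ : IwasawaAlgebra 2, IsEvenBranchLiftAtTwo W₁ f₁ G₁ → IsEvenBranchLiftAtTwo W₂ f₂ G₂ →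
        lam G₁ + ∑ ℓ ∈ (W₁.conductorNorm ℤ * W₂.conductorNorm ℤ).primeFactors.erase 2, lambdaCorrectionAtTwo W₁ ℓ =
          lam G₂ + ∑ ℓ ∈ (W₁.conductorNorm ℤ * W₂.conductorNorm ℤ).primeFactors.erase 2, lambdaCorrectionAtTwo W₂ ℓ :=
  lamLawDeltaPos_of_print hSD hBz hΩu hJ fun W _ _ _ hord ht ↦ exists_datum_odd_maninConstant hmod hNS hΩu W hord ht

end Summit.BirchSwinnertonDyer.BirchSwinnertonDyer.Theorems.AlignedTransportAtTwoDeltaPosCongruenceLevelOfFacts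

end
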